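import Summits.KontsevichZagierPeriods.KontsevichZagierPeriods.Theorems.HurwitzMicroSectorsNormalFormPrincipleL2W3PrismDilationMove

/-!
# `NormalFormPrinciple` (stmt-KontsevichZagierPeriods-3869), line `SketchIdeator1` —
# leaf `stub_boxRigidity`, layer L2W3 (level-2 weight-3 descent): the prism chart of the unit cube

Pure proof file (stub `l2w3_box_sub_prism` of the layer `L2W3`, lead seat c9; `--supports` the
crux). The instance `HalfPointZetaTwoLogTwo`, `[(0,1)³, 4/((2 − x)(1 − xyz))] ∼
[(0,1)³, 3/((1 − xy)(1 + z))]`, compares a box with the PRODUCT box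
`[(0,1)³, 3/((1 − xy)(1 + z))]` (value `3ζ(2)·log 2`). The first link of the lead's move chain on
the product side is supplied here: ONE change-of-variables move (rule (2)) of the
Kontsevich–Zagier calculus along the *prism chart* of the open unit cube `□³ = (0,1)³`,

  `Ψ(x₀, x₁, x₂) = (x₀, x₀x₁, x₂)`, `DΨ(x) = !![1, 0, 0; x₁, x₀, 0; 0, 0, 1]`, `det DΨ = x₀`,

(the two-dimensional merge–scale chart on `(x₀, x₁)` times the identity on `x₂`): a
`ℚ`-polynomial (hence `ℚ`-semialgebraic) map, injective on `□³` (`x₁ = t₁/t₀`) with image the open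
prism `P = {0 < t₁ < t₀ < 1, 0 < t₂ < 1}`. Part (1) is the rule-(2) move for a GENERIC target
integrand `g` on `P`: the hypothesis `N.integrand x = g (Ψ x) · x₀` on `□³` is literally the
pull-back identity `N.integrand x = T.integrand (Ψ x) · |det DΨ(x)|` demanded by rule (2).
Part (2) is the EXISTENCE of the two prism carriers `[P, (1/t₀)(1/(1 − t₁))(1/(1 + t₂))]` and
`[P, (1/t₀)(1/(1 + t₁))(1/(1 + t₂))]`: `P` is cut out by strict `ℚ`-polynomial inequalities, the
integrands are quotients of `ℚ`-polynomials with non-vanishing denominators on `P`, absolute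
convergence of the first is transported from the product box along `Ψ` by Mathlib's Jacobian
criterion `MeasureTheory.integrableOn_image_iff_integrableOn_abs_det_fderiv_smul`
(`x₀ · (1/x₀)(1/(1 − x₀x₁))(1/(1 + x₂)) = (1/3) · 3/((1 − x₀x₁)(1 + x₂))` on `□³`), and the second
is dominated by the first (`1/(1 + t₁) ≤ 1/(1 − t₁)` on `P`). Pattern of `ebd_box_sub_simplex`
and `wdt1_exists_wedgeChart` (this line, layer `M3`).

References: M. Kontsevich, D. Zagier, *Periods* (2001), §1.1–1.2 (rule (2)). No definitions are
introduced.
-/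

noncomputable section

open MeasureTheory Set
open Literature.NumberTheory.Transcendental Literature.NumberTheory.Transcendental.KZ
open Literature.ModelTheory.ExponentialFields (IsSemialgebraic)

namespace Summit.KontsevichZagierPeriods.HurwitzMicroSectors.NormalFormPrinciple.PiBox.M3

/-! ## The prism chart -/

/-- **The prism chart `Ψ(x₀,x₁,x₂) = (x₀, x₀x₁, x₂)`** of the open unit cube: a `ℚ`-polynomial
(hence `ℚ`-semialgebraic) map, differentiable with derivative `!![1, 0, 0; x₁, x₀, 0; 0, 0, 1]`
and `|det DΨ| = x₀` on the cube, injective on the cube (`x₀ ≠ 0` there) and ONTO the open prism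
`{0 < t₁ < t₀ < 1, 0 < t₂ < 1}` (inverse `t ↦ (t₀, t₁/t₀, t₂)`). [folklore] -/
theorem l2p_exists_prismChart :
    ∃ (Ψ : (Fin 3 → ℝ) → (Fin 3 → ℝ)) (Ψ' : (Fin 3 → ℝ) → (Fin 3 → ℝ) →L[ℝ] (Fin 3 → ℝ)),
      (∀ x, Ψ x = ![x 0, x 0 * x 1, x 2]) ∧
      IsSemialgebraicMapOn ℚ {x : Fin 3 → ℝ | ∀ i, x i ∈ Set.Ioo (0:ℝ) 1} Ψ ∧
      (∀ x, HasFDerivAt Ψ (Ψ' x) x) ∧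
      Set.InjOn Ψ {x : Fin 3 → ℝ | ∀ i, x i ∈ Set.Ioo (0:ℝ) 1} ∧
      Ψ '' {x : Fin 3 → ℝ | ∀ i, x i ∈ Set.Ioo (0:ℝ) 1} =
        {t | 0 < t 1 ∧ t 1 < t 0 ∧ t 0 < 1 ∧ 0 < t 2 ∧ t 2 < 1} ∧
      (∀ x ∈ {x : Fin 3 → ℝ | ∀ i, x i ∈ Set.Ioo (0:ℝ) 1}, |(Ψ' x).det| = x 0) := by
  set Ψ : (Fin 3 → ℝ) → (Fin 3 → ℝ) := fun x => ![x 0, x 0 * x 1, x 2]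
  set Ψ' : (Fin 3 → ℝ) → (Fin 3 → ℝ) →L[ℝ] (Fin 3 → ℝ) := fun x =>
    LinearMap.toContinuousLinearMap (Matrix.toLin' !![(1:ℝ), 0, 0; x 1, x 0, 0; 0, 0, 1])
  have hΨ0 : ∀ x, Ψ x 0 = x 0 := fun x => rfl
  have hΨ1 : ∀ x, Ψ x 1 = x 0 * x 1 := fun x => rfl
  have hΨ2 : ∀ x, Ψ x 2 = x 2 := fun x => rfl
  have hΨ'0 : ∀ x v : Fin 3 → ℝ, Ψ' x v 0 = v 0 := by
    intro x v
    change Matrix.toLin' !![(1:ℝ), 0, 0; x 1, x 0, 0; 0, 0, 1] v 0 = _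
    rw [Matrix.toLin'_apply]
    simp [Matrix.mulVec, dotProduct, Fin.sum_univ_three]
  have hΨ'1 : ∀ x v : Fin 3 → ℝ, Ψ' x v 1 = x 1 * v 0 + x 0 * v 1 := by
    intro x v
    change Matrix.toLin' !![(1:ℝ), 0, 0; x 1, x 0, 0; 0, 0, 1] v 1 = _
    rw [Matrix.toLin'_apply]
    simp [Matrix.mulVec, dotProduct, Fin.sum_univ_three]
  have hΨ'2 : ∀ x v : Fin 3 → ℝ, Ψ' x v 2 = v 2 := by
    intro x v
    change Matrix.toLin' !![(1:ℝ), 0, 0; x 1, x 0, 0; 0, 0, 1] v 2 = _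
    rw [Matrix.toLin'_apply]
    simp [Matrix.mulVec, dotProduct, Fin.sum_univ_three]
  have hdet : ∀ x, (Ψ' x).det = x 0 := by
    intro x
    change LinearMap.det (Matrix.toLin' !![(1:ℝ), 0, 0; x 1, x 0, 0; 0, 0, 1]) = _
    rw [LinearMap.det_toLin', Matrix.det_fin_three]
    simp only [Matrix.of_apply, Matrix.cons_val', Matrix.cons_val_zero, Matrix.cons_val_one,
      Matrix.cons_val_two, Matrix.empty_val', Matrix.cons_val_fin_one, Matrix.head_cons,
      Matrix.tail_cons, Matrix.head_fin_const]
    ring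
  have hderiv : ∀ x, HasFDerivAt Ψ (Ψ' x) x := by
    intro x
    have h0 : HasFDerivAt (fun y : Fin 3 → ℝ => y 0)
        (ContinuousLinearMap.proj (R := ℝ) (φ := fun _ : Fin 3 => ℝ) 0) x := hasFDerivAt_apply 0 x
    have h1 : HasFDerivAt (fun y : Fin 3 → ℝ => y 1)
        (ContinuousLinearMap.proj (R := ℝ) (φ := fun _ : Fin 3 => ℝ) 1) x := hasFDerivAt_apply 1 x
    have h2 : HasFDerivAt (fun y : Fin 3 → ℝ => y 2)
        (ContinuousLinearMap.proj (R := ℝ) (φ := fun _ : Fin 3 => ℝ) 2) x := hasFDerivAt_apply 2 x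
    rw [hasFDerivAt_pi']
    refine Fin.forall_fin_succ.2 ⟨?_, Fin.forall_fin_two.2 ⟨?_, ?_⟩⟩
    · show HasFDerivAt (fun y : Fin 3 → ℝ => y 0) _ x
      refine h0.congr_fderiv (ContinuousLinearMap.ext fun v => ?_)
      show v 0 = Ψ' x v 0
      rw [hΨ'0]
    · show HasFDerivAt (fun y : Fin 3 → ℝ => y 0 * y 1) _ x
      refine (h0.mul h1).congr_fderiv (ContinuousLinearMap.ext fun v => ?_)
      show x 0 * v 1 + x 1 * v 0 = Ψ' x v 1
      rw [hΨ'1]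
      ring
    · show HasFDerivAt (fun y : Fin 3 → ℝ => y 2) _ x
      refine h2.congr_fderiv (ContinuousLinearMap.ext fun v => ?_)
      show v 2 = Ψ' x v 2
      rw [hΨ'2]
  refine ⟨Ψ, Ψ', fun x => rfl, ?_, hderiv, ?_, ?_, fun x hx => ?_⟩
  · -- a `ℚ`-polynomial map is `ℚ`-semialgebraic
    convert isSemialgebraicMapOn_aeval (isSemialgebraic_box 3)
      ![(MvPolynomial.X 0 : MvPolynomial (Fin 3) ℚ), MvPolynomial.X 0 * MvPolynomial.X 1,
        MvPolynomial.X 2] using 2 with x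
    funext i
    fin_cases i
    · simp [hΨ0]
    · simp [hΨ1]
    · simp [hΨ2]
  · -- injective on the cube (`x₀ ≠ 0` there)
    intro x _ y hy hxy
    have e0 : x 0 = y 0 := congrFun hxy 0
    have e1 : x 0 * x 1 = y 0 * y 1 := congrFun hxy 1
    have e2 : x 2 = y 2 := congrFun hxy 2
    rw [e0] at e1
    have f1 : x 1 = y 1 := mul_left_cancel₀ (hy 0).1.ne' e1
    funext i
    fin_cases i
    · exact e0
    · exact f1
    · exact e2
  · -- onto the prism
    ext t
    constructor
    · rintro ⟨x, hx, rfl⟩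
      refine ⟨?_, ?_, ?_, ?_, ?_⟩
      · show 0 < x 0 * x 1
        exact mul_pos (hx 0).1 (hx 1).1
      · show x 0 * x 1 < x 0
        exact mul_lt_of_lt_one_right (hx 0).1 (hx 1).2
      · show x 0 < 1
        exact (hx 0).2
      · show 0 < x 2
        exact (hx 2).1
      · show x 2 < 1
        exact (hx 2).2
    · rintro ⟨h1, h10, h0, h2, h21⟩
      have ht0 : 0 < t 0 := h1.trans h10
      refine ⟨![t 0, t 1 / t 0, t 2], ?_, ?_⟩
      · refine Fin.forall_fin_succ.2 ⟨⟨ht0, h0⟩, Fin.forall_fin_two.2 ⟨?_, ?_⟩⟩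
        · exact ⟨div_pos h1 ht0, (div_lt_one ht0).2 h10⟩
        · exact ⟨h2, h21⟩
      · refine funext (Fin.forall_fin_succ.2 ⟨rfl, Fin.forall_fin_two.2 ⟨?_, rfl⟩⟩)
        show t 0 * (t 1 / t 0) = t 1
        exact mul_div_cancel₀ _ ht0.ne'
  · -- the Jacobian
    rw [hdet, abs_of_pos (hx 0).1]

/-! ## The two prism carriers: semialgebraicity of the integrands

(The prism itself is `ℚ`-semialgebraic by `l2q_isSemialgebraic_prism` of the sibling file
`…L2W3PrismDilationMove`.) -/

/-- **Semialgebraicity of the first prism integrand `(1/t₀)(1/(1 − t₁))(1/(1 + t₂))`** on any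
`ℚ`-semialgebraic set on which `t₀ ≠ 0`, `t₁ ≠ 1`, `t₂ ≠ −1`: a quotient of `ℚ`-polynomials with
non-vanishing denominator (`isSemialgebraicFunOn_aeval_div_aeval`).
[cite: KontsevichZagier2001, §1.1] -/
theorem l2p_isSemialgebraicFunOn_prismIntegrand_sub {σ : Set (Fin 3 → ℝ)}
    (hσ : IsSemialgebraic ℚ σ) (h0 : ∀ t ∈ σ, t 0 ≠ 0) (h1 : ∀ t ∈ σ, 1 - t 1 ≠ 0)
    (h2 : ∀ t ∈ σ, 1 + t 2 ≠ 0) :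
    IsSemialgebraicFunOn ℚ σ (fun t => 1 / t 0 * (1 / (1 - t 1)) * (1 / (1 + t 2))) := by
  refine (isSemialgebraicFunOn_aeval_div_aeval hσ (1 : MvPolynomial (Fin 3) ℚ)
    (MvPolynomial.X 0 * (1 - MvPolynomial.X 1) * (1 + MvPolynomial.X 2))
    fun t ht => ?_).congr fun t _ => ?_
  · simp only [map_mul, map_sub, map_add, map_one, MvPolynomial.aeval_X]
    exact mul_ne_zero (mul_ne_zero (h0 t ht) (h1 t ht)) (h2 t ht)
  · simp only [map_mul, map_sub, map_add, map_one, MvPolynomial.aeval_X, one_div_mul_one_div]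

/-- **Semialgebraicity of the second prism integrand `(1/t₀)(1/(1 + t₁))(1/(1 + t₂))`** on any
`ℚ`-semialgebraic set on which `t₀ ≠ 0`, `t₁ ≠ −1`, `t₂ ≠ −1`: a quotient of `ℚ`-polynomials with
non-vanishing denominator (`isSemialgebraicFunOn_aeval_div_aeval`).
[cite: KontsevichZagier2001, §1.1] -/
theorem l2p_isSemialgebraicFunOn_prismIntegrand_add {σ : Set (Fin 3 → ℝ)}
    (hσ : IsSemialgebraic ℚ σ) (h0 : ∀ t ∈ σ, t 0 ≠ 0) (h1 : ∀ t ∈ σ, 1 + t 1 ≠ 0)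
    (h2 : ∀ t ∈ σ, 1 + t 2 ≠ 0) :
    IsSemialgebraicFunOn ℚ σ (fun t => 1 / t 0 * (1 / (1 + t 1)) * (1 / (1 + t 2))) := by
  refine (isSemialgebraicFunOn_aeval_div_aeval hσ (1 : MvPolynomial (Fin 3) ℚ)
    (MvPolynomial.X 0 * (1 + MvPolynomial.X 1) * (1 + MvPolynomial.X 2))
    fun t ht => ?_).congr fun t _ => ?_
  · simp only [map_mul, map_add, map_one, MvPolynomial.aeval_X]
    exact mul_ne_zero (mul_ne_zero (h0 t ht) (h1 t ht)) (h2 t ht)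
  · simp only [map_mul, map_add, map_one, MvPolynomial.aeval_X, one_div_mul_one_div]

/-! ## The registered sub-goal -/

/-- **Stub L6 (`l2w3_box_sub_prism`; registered sub-goal of stmt-KontsevichZagierPeriods-3869,
line `SketchIdeator1`, layer L2W3).** (1) The prism substitution `(x₀,x₁,x₂) ↦ (x₀, x₀x₁, x₂)`
(rule 2, Jacobian `x₀`) identifies a representation `N` on the open unit cube `(0,1)³` with a
representation `T` on the open prism `{0 < t₁ < t₀ < 1, 0 < t₂ < 1}` with integrand `g` there,
as soon as `N.integrand x = g (Ψ x) · x₀` on the cube — as ONE change-of-variables move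
`KZ.changeOfVariablesRel` of the Kontsevich–Zagier calculus along the chart
`l2p_exists_prismChart` (source `N`, image `T`). (2) Given a representation `r'` of the product
box `[(0,1)³, 3/((1 − x₀x₁)(1 + x₂))]`, the two prism carriers
`[P, (1/t₀)(1/(1 − t₁))(1/(1 + t₂))]` and `[P, (1/t₀)(1/(1 + t₁))(1/(1 + t₂))]` exist: domain and
integrands are `ℚ`-semialgebraic (`l2q_isSemialgebraic_prism`,
`l2p_isSemialgebraicFunOn_prismIntegrand_sub/_add`), absolute convergence of the first is
transported from `r'` along `Ψ`
(`MeasureTheory.integrableOn_image_iff_integrableOn_abs_det_fderiv_smul`), and the second is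
dominated by the first. [cite: KontsevichZagier2001, §1.2 rule (2)] -/
theorem l2w3_box_sub_prism :
    (∀ (g : (Fin 3 → ℝ) → ℝ) (N T : IntegralRep 3),
      N.domain = {x | ∀ i, x i ∈ Set.Ioo (0:ℝ) 1} →
      T.domain = {t | 0 < t 1 ∧ t 1 < t 0 ∧ t 0 < 1 ∧ 0 < t 2 ∧ t 2 < 1} →
      EqOn T.integrand g T.domain →
      EqOn N.integrand (fun x => g ![x 0, x 0 * x 1, x 2] * x 0) N.domain →
      of N - of T ∈ relations) ∧
    (∀ (r' : IntegralRep 3), r'.domain = {x | ∀ i, x i ∈ Set.Ioo (0:ℝ) 1} →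
      EqOn r'.integrand (fun x => 3 / ((1 - x 0 * x 1) * (1 + x 2))) r'.domain →
      (∃ T : IntegralRep 3, T.domain = {t | 0 < t 1 ∧ t 1 < t 0 ∧ t 0 < 1 ∧ 0 < t 2 ∧ t 2 < 1} ∧
        T.integrand = fun t => 1 / t 0 * (1 / (1 - t 1)) * (1 / (1 + t 2))) ∧
      (∃ T : IntegralRep 3, T.domain = {t | 0 < t 1 ∧ t 1 < t 0 ∧ t 0 < 1 ∧ 0 < t 2 ∧ t 2 < 1} ∧
        T.integrand = fun t => 1 / t 0 * (1 / (1 + t 1)) * (1 / (1 + t 2)))) := by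
  obtain ⟨Ψ, Ψ', hΨ, hsa, hderiv, hinj, himage, hdet⟩ := l2p_exists_prismChart
  refine ⟨fun g N T hNd hTd hTg hNi => ?_, fun r' hr'd hr'i => ?_⟩
  · -- part (1): ONE rule-(2) move along the prism chart
    have himage' : T.domain = Ψ '' N.domain := by rw [hNd, himage, hTd]
    have hsa' : IsSemialgebraicMapOn ℚ N.domain Ψ := by rw [hNd]; exact hsa
    have hinj' : InjOn Ψ N.domain := by rw [hNd]; exact hinj
    refine changeOfVariablesRel_subset_relations
      ⟨3, N, T, Ψ, Ψ', hsa', fun x _ => (hderiv x).hasFDerivWithinAt, hinj', himage',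
        fun x hx => ?_, rfl⟩
    -- the pull-back identity on `N.domain`, Jacobian `|det DΨ| = x₀` included
    have hΨx : Ψ x ∈ T.domain := himage' ▸ mem_image_of_mem _ hx
    have hx' : ∀ i, x i ∈ Set.Ioo (0:ℝ) 1 := by rw [hNd] at hx; exact hx
    rw [hNi hx, hTg hΨx, hdet x hx', hΨ x]
  · -- part (2): the two prism carriers exist
    have hσ := l2q_isSemialgebraic_prism
    have hP : MeasurableSet {t : Fin 3 → ℝ | 0 < t 1 ∧ t 1 < t 0 ∧ t 0 < 1 ∧ 0 < t 2 ∧ t 2 < 1} :=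
      hσ.measurableSet_holds
    have hS : MeasurableSet {x : Fin 3 → ℝ | ∀ i, x i ∈ Set.Ioo (0:ℝ) 1} :=
      (isSemialgebraic_box 3).measurableSet_holds
    have hr : IntegrableOn r'.integrand {x : Fin 3 → ℝ | ∀ i, x i ∈ Set.Ioo (0:ℝ) 1} :=
      hr'd ▸ r'.integrableOn
    have hri' : EqOn r'.integrand (fun x => 3 / ((1 - x 0 * x 1) * (1 + x 2)))
        {x : Fin 3 → ℝ | ∀ i, x i ∈ Set.Ioo (0:ℝ) 1} := hr'd ▸ hr'i
    -- integrability of the first carrier, transported from the product box along `Ψ`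
    have hint1 : IntegrableOn (fun t : Fin 3 → ℝ => 1 / t 0 * (1 / (1 - t 1)) * (1 / (1 + t 2)))
        {t | 0 < t 1 ∧ t 1 < t 0 ∧ t 0 < 1 ∧ 0 < t 2 ∧ t 2 < 1} := by
      have h3 : IntegrableOn (fun x : Fin 3 → ℝ => 1 / 3 * (3 / ((1 - x 0 * x 1) * (1 + x 2))))
          {x : Fin 3 → ℝ | ∀ i, x i ∈ Set.Ioo (0:ℝ) 1} :=
        (hr.congr_fun hri' hS).const_mul (1 / 3)
      rw [← himage, integrableOn_image_iff_integrableOn_abs_det_fderiv_smul volume hS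
        (fun x _ => (hderiv x).hasFDerivWithinAt) hinj]
      refine h3.congr_fun (fun x hx => ?_) hS
      have h0 : x 0 ≠ 0 := (hx 0).1.ne'
      have h01 : 1 - x 0 * x 1 ≠ 0 :=
        (sub_pos.2 (mul_lt_one_of_nonneg_of_lt_one_left (hx 0).1.le (hx 0).2 (hx 1).2.le)).ne'
      have h2 : 1 + x 2 ≠ 0 := (add_pos one_pos (hx 2).1).ne'
      show 1 / 3 * (3 / ((1 - x 0 * x 1) * (1 + x 2))) =
        |(Ψ' x).det| • (1 / Ψ x 0 * (1 / (1 - Ψ x 1)) * (1 / (1 + Ψ x 2)))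
      rw [hdet x hx, hΨ x, smul_eq_mul]
      simp only [Matrix.cons_val_zero, Matrix.cons_val_one, Matrix.cons_val_two, Matrix.head_cons,
        Matrix.tail_cons]
      field_simp
    -- integrability of the second carrier, dominated by the first on the prism
    have hint2 : IntegrableOn (fun t : Fin 3 → ℝ => 1 / t 0 * (1 / (1 + t 1)) * (1 / (1 + t 2)))
        {t | 0 < t 1 ∧ t 1 < t 0 ∧ t 0 < 1 ∧ 0 < t 2 ∧ t 2 < 1} := by
      have hcont : ContinuousOn (fun t : Fin 3 → ℝ => 1 / t 0 * (1 / (1 + t 1)) * (1 / (1 + t 2)))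
          {t | 0 < t 1 ∧ t 1 < t 0 ∧ t 0 < 1 ∧ 0 < t 2 ∧ t 2 < 1} := by
        refine ContinuousOn.mul (ContinuousOn.mul ?_ ?_) ?_
        · exact continuousOn_const.div (continuous_apply 0).continuousOn
            fun t ht => (ht.1.trans ht.2.1).ne'
        · exact continuousOn_const.div (continuous_const.add (continuous_apply 1)).continuousOn
            fun t ht => (add_pos one_pos ht.1).ne'
        · exact continuousOn_const.div (continuous_const.add (continuous_apply 2)).continuousOn
            fun t ht => (add_pos one_pos ht.2.2.2.1).ne'
      refine Integrable.mono' hint1 (hcont.aestronglyMeasurable hP)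
        (ae_restrict_of_forall_mem hP fun t ht => ?_)
      obtain ⟨h1, h10, h01, h2, -⟩ := ht
      have ht0 : 0 < t 0 := h1.trans h10
      have hA : 0 < 1 + t 1 := add_pos one_pos h1
      have hB : 0 < 1 - t 1 := sub_pos.2 (h10.trans h01)
      have hC : 0 < 1 + t 2 := add_pos one_pos h2
      show ‖1 / t 0 * (1 / (1 + t 1)) * (1 / (1 + t 2))‖ ≤
        1 / t 0 * (1 / (1 - t 1)) * (1 / (1 + t 2))
      rw [Real.norm_eq_abs, abs_of_nonneg (mul_nonneg (mul_nonneg (one_div_pos.2 ht0).le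
        (one_div_pos.2 hA).le) (one_div_pos.2 hC).le)]
      exact mul_le_mul_of_nonneg_right (mul_le_mul_of_nonneg_left
        (one_div_le_one_div_of_le hB (by linarith)) (one_div_pos.2 ht0).le) (one_div_pos.2 hC).le
    exact ⟨⟨⟨_, _, hσ, l2p_isSemialgebraicFunOn_prismIntegrand_sub hσ
        (fun _ ht => (ht.1.trans ht.2.1).ne') (fun _ ht => (sub_pos.2 (ht.2.1.trans ht.2.2.1)).ne')
        (fun _ ht => (add_pos one_pos ht.2.2.2.1).ne'), hint1⟩, rfl, rfl⟩,
      ⟨⟨_, _, hσ, l2p_isSemialgebraicFunOn_prismIntegrand_add hσ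
        (fun _ ht => (ht.1.trans ht.2.1).ne') (fun _ ht => (add_pos one_pos ht.1).ne')
        (fun _ ht => (add_pos one_pos ht.2.2.2.1).ne'), hint2⟩, rfl, rfl⟩⟩

end Summit.KontsevichZagierPeriods.HurwitzMicroSectors.NormalFormPrinciple.PiBox.M3
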